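import Literature.MathematicalPhysics.QuantumFieldTheory.Balaban1983to89.B6InMajorantTransplant

/-!
# `Balaban1983to89.B6InDecayWindowV1` — T. Bałaban, *Propagators and renormalization transformations for lattice gauge theories. II*,
# Commun. Math. Phys. **96** (1984) 223–250 [Balaban1984PropagatorsII], (2.133)–(2.134) p. 247 with p. 238 (*"we take the cube □̃³ and identify it
# with a torus T_□"*): INPUT- (and OUTPUT-) LOCALISED MAJORANTS **WITH GLOBAL DECAY** for operators of `T_□` transplanted through a FULL window —
# the band bridge «torus distance of `T_□` ≥ κ·(flat distance)» for pairs with one end in the middle band of the window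

statement-level skeleton of published theorems with citation tags; proofs where landed; nothing here is a claim about the Yang–Mills mass gap

PDF held: `paper:balaban1984-cmp96-propagators-rt-ii` (journal page = PDF page + 222): p. 238 [PDF 16] (□ ⊂ □̃ ⊂ □̃² ⊂ □̃³ = T_□: the operators
`G_□` of (2.90) live on the torus `T_□`, their INPUTS `h_□J` are central), p. 247 [PDF 25] ((2.133): *"|(G_□J)(x)|, |(∇G_□J)(x)| ≤ O(1)[(L^jη)², L^jη]
e^{−δ₂|y−y′|}|J| for x ∈ Δ(y), supp J ⊂ Δ(y′), y, y′ ∈ 𝔅 ∩ T_□"*; (2.134) reads `G_□′h_□′J` at ARBITRARY outputs).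

CITATION HEADER (lean-in-tree rule) — WHAT IS REPRODUCED.  Phase-2 file of the `lit-balaban` typed skeleton (HOME `run/shared/lean/pub/lit-balaban/`),
seat **r03 gen 21** (row owner of B6.Prop2.6); SKELETON rows **B6.Eq2.133** × **B6.Eq2.134** × B6.Prop2.6 (cells).  Owner's finding F4 (B6-CLOSURE §5
item 14) and p38 g27's answer (seat INBOX 2026-08-23T06:13:15Z): the (2.134) consumer `…B6Ineq2134KFamKLevelTorus.h2134_kFam_torus` needs, for the
window members `G_□`, `∇G_□`, `Q*a_□Q`, `∂P_□∂*` of the cubes, majorants with INPUTS over the central reach `T_□ ⊃ supp h_□`, OUTPUTS ANYWHERE, and DECAY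
in the GLOBAL multiscale distance `d` — while a transplanted torus member only decays in the torus distance of `T_□`, which vanishes at wrap-around
pairs.  THIS FILE proves the bridge: if the input sits in the MIDDLE BAND of the window (torus labels `q₁` with `(C+1)(q₁+1) ≥ M`, `(C+1)q₁ ≤ C·M`,
`M` the label period), then for EVERY output label `q` of the window `|q − q₁| ≤ C·|q − q₁|_{T_□}` (§2), hence the flat sup-distance of the points is
`≤ L^j·C·|y − y₁|_{T_□} + (L^j − 1)` (§3), hence the global distance `d(y(x), y(x₁)) ≤ C(d+1)·|·|_{T_□} + 2(d+1)` and the member's `A·e^{−δ|·|_T}`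
is `≤ A·e^{2δ/C}·e^{−(δ/(C(d+1)))·d}` (§4: `inMajorant_transplant_of_band`, and the output-localised twin `outMajorant_transplant_of_band` for the
notion **`OutMajorant`** of §1); §5 fires both on the V1 global torus `T_η` (p21's `TDomains`/`geomT`, r03's full bond window `cB t x₀`):
**`inDecay_window_V1`**, **`outDecay_window_V1`** — for ANY member operator `T′` with a (2.133)-shape majorant on `T_□` (p22/p38's `ineq2133_G`,
`ineq2133_DG`, `ineq2133_DlaG`, `ineq2133_QaQ`, `ineq288_twoScale` all have this shape).
No new definition of mathematical content beyond `OutMajorant`; no new fact; standard axioms.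

HONEST SCOPE / DIVERGENCES. (1) Print centres `T_□ = □̃³` at the cube, so there `|·|_{T_□} ≥ ⅓·(flat)` for central inputs; our windows are anchored at
a corner (`B6CubeWindowV1`: the cube centre sits at the quarter point), and the band condition then holds for the reach `□⁺` only when `L ≥ 5` (file
`B6CubeInDecayV1`); the lemmas here are corner-agnostic. (2) The factor `C` in the rate (`δ ↦ δ/(C(d+1))`) is ours (print: `δ₂ ↦ ½δ₂`). (3) Bookkeeping
only; NOT summit progress.  Unit `lit-balaban-r03` (gen 21), 2026-08-23.
-/

noncomputable section

open scoped BigOperators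
open Finset

namespace Literature.MathematicalPhysics.QuantumFieldTheory.Balaban1983to89.B6InDecayWindowV1

open B6RandomWalk (HasMajorant BlockSupp blockPiece sum_blockPiece blockSupp_blockPiece)
open B6Prop26Gluing (LocalMajorant)
open B6Prop26ReachTransplant (restrictOp transplant restrictOp_apply transplant_apply restrictOp_apply_of_injOn restrictOp_apply_of_not_mem
  siteOfInt chartBond chartBond_src InWindow injOn_chartBond_full val_siteOfInt rep_iterBlockOf_siteOfInt sitesPerDir_zero sitesPerDir_j
  expKernel_le_of_dist_le)
open B6InMajorantTransplant (InMajorant inMajorant_transplant)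
open B4TorusKernel.MultiPeriod (circAbs circAbs_nonneg circAbs_of_centred circAbs_add_mul torusSupNorm)
open B4ContourShift (supNorm abs_le_supNorm supNorm_nonneg)

/-! ## §1  Output-localised majorants (the transposed companion of `InMajorant`) -/

section Out

variable {g : B6.Geometry} {X : Type}

/-- **OUTPUT-LOCALISED MAJORANT**: `|(Tμ)(x)| ≤ K(y(x), y′)·B` for EVERY input block `y′` (`supp μ ⊂ Δ(y′)`, `|μ| ≤ B`) and every output point `x`
whose block lies in `S` (print reads `h_□′(…)G_□′` / `ζ_□′(…)`: outputs cut to the central region, inputs unrestricted).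
[cite: Balaban1984PropagatorsII, (2.133)–(2.134) p.247, (2.91)–(2.93) p.239] -/
def OutMajorant (blk : X → g.Site) (T : Module.End ℝ (X → ℝ)) (S : Set g.Site) (K : g.Site → g.Site → ℝ) : Prop :=
  ∀ (y' : g.Site) (μ : X → ℝ) (B : ℝ), BlockSupp blk μ y' B → ∀ x : X, blk x ∈ S → |T μ x| ≤ K (blk x) y' * B

/-- a global majorant is an output-localised one on every set. [cite: Balaban1984PropagatorsII, (2.51) p.232, bookkeeping] -/
theorem outMajorant_of_hasMajorant (blk : X → g.Site) {T : Module.End ℝ (X → ℝ)} {K : g.Site → g.Site → ℝ} (h : HasMajorant blk T K)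
    (S : Set g.Site) : OutMajorant blk T S K :=
  fun y' μ B hμ x _ => h y' μ B hμ x

/-- an output-localised majorant is a local one on its set. [cite: Balaban1984PropagatorsII, (2.133) p.247, bookkeeping] -/
theorem OutMajorant.localMajorant {blk : X → g.Site} {T : Module.End ℝ (X → ℝ)} {S : Set g.Site} {K : g.Site → g.Site → ℝ}
    (h : OutMajorant blk T S K) : LocalMajorant blk T S K :=
  fun y' _ μ B hμ x hx => h y' μ B hμ x hx

/-- monotonicity in the kernel (outputs over `S`). [cite: Balaban1984PropagatorsII, (2.133) p.247, bookkeeping] -/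
theorem outMajorant_mono (blk : X → g.Site) {T : Module.End ℝ (X → ℝ)} {S : Set g.Site} {K K' : g.Site → g.Site → ℝ}
    (h : OutMajorant blk T S K) (hle : ∀ a ∈ S, ∀ b, K a b ≤ K' a b) : OutMajorant blk T S K' :=
  fun y' μ B hμ x hx => (h y' μ B hμ x hx).trans (mul_le_mul_of_nonneg_right (hle _ hx _) hμ.nonneg)

/-- scaling. [cite: Balaban1984PropagatorsII, (2.94) p.239, bookkeeping] -/
theorem outMajorant_smul (blk : X → g.Site) {T : Module.End ℝ (X → ℝ)} {S : Set g.Site} {K : g.Site → g.Site → ℝ}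
    (h : OutMajorant blk T S K) (s : ℝ) : OutMajorant blk (s • T) S (fun a b => |s| * K a b) := by
  intro y' μ B hμ x hx
  rw [LinearMap.smul_apply, Pi.smul_apply, smul_eq_mul, abs_mul, mul_assoc]
  exact mul_le_mul_of_nonneg_left (h y' μ B hμ x hx) (abs_nonneg _)

/-- the set may be replaced by one with the same members. [cite: Balaban1984PropagatorsII, (2.133) p.247, bookkeeping] -/
theorem outMajorant_congr_set (blk : X → g.Site) {T : Module.End ℝ (X → ℝ)} {S S' : Set g.Site} {K : g.Site → g.Site → ℝ}
    (hS : ∀ a, a ∈ S ↔ a ∈ S') (h : OutMajorant blk T S K) : OutMajorant blk T S' K :=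
  fun y' μ B hμ x hx => h y' μ B hμ x ((hS _).2 hx)

/-- restriction to a smaller output set. [cite: Balaban1984PropagatorsII, (2.133) p.247, bookkeeping] -/
theorem outMajorant_subset (blk : X → g.Site) {T : Module.End ℝ (X → ℝ)} {S S' : Set g.Site} {K : g.Site → g.Site → ℝ}
    (h : OutMajorant blk T S K) (hS : S' ⊆ S) : OutMajorant blk T S' K :=
  fun y' μ B hμ x hx => h y' μ B hμ x (hS hx)

/-- **SCALING WITH A WEIGHT VALID ON THE SUPPORT OF THE OUTPUTS** (input-localised form): if `T` only produces outputs in `W` (a transplant vanishes off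
its window) and `s·K(y(x), b) ≤ K′(y(x), b)` for `x ∈ W`, `b ∈ S`, then `s • T` has the input-localised majorant `K′` (used with `s = (L^{j₀}/c′)² ≤
(L^{j(y(x))}/c′)²` on the two-level window: print's prefactor `(L^jη)²` of (2.133)/(2.136)). [cite: Balaban1984PropagatorsII, (2.94) p.239, (2.133) p.247, bookkeeping] -/
theorem inMajorant_smul_of_le_on (blk : X → g.Site) {T : Module.End ℝ (X → ℝ)} {S : Set g.Site} {K K' : g.Site → g.Site → ℝ}
    (h : InMajorant blk T S K) (W : Finset X) (hW : ∀ μ x, x ∉ W → T μ x = 0) {s : ℝ} (hs : 0 ≤ s) (hK' : ∀ a b, 0 ≤ K' a b)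
    (hle : ∀ x ∈ W, ∀ b ∈ S, s * K (blk x) b ≤ K' (blk x) b) : InMajorant blk (s • T) S K' := by
  intro y' hy' μ B hμ x
  rw [LinearMap.smul_apply, Pi.smul_apply, smul_eq_mul]
  by_cases hx : x ∈ W
  · rw [abs_mul, abs_of_nonneg hs]
    calc s * |T μ x| ≤ s * (K (blk x) y' * B) := mul_le_mul_of_nonneg_left (h y' hy' μ B hμ x) hs
      _ = s * K (blk x) y' * B := by ring
      _ ≤ K' (blk x) y' * B := mul_le_mul_of_nonneg_right (hle x hx y' hy') hμ.nonneg
  · rw [hW μ x hx, mul_zero, abs_zero]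
    exact mul_nonneg (hK' _ _) hμ.nonneg

/-- the same for output-localised majorants. [cite: Balaban1984PropagatorsII, (2.94) p.239, (2.133) p.247, bookkeeping] -/
theorem outMajorant_smul_of_le_on (blk : X → g.Site) {T : Module.End ℝ (X → ℝ)} {S : Set g.Site} {K K' : g.Site → g.Site → ℝ}
    (h : OutMajorant blk T S K) (W : Finset X) (hW : ∀ μ x, x ∉ W → T μ x = 0) {s : ℝ} (hs : 0 ≤ s) (hK' : ∀ a b, 0 ≤ K' a b)
    (hle : ∀ x ∈ W, blk x ∈ S → ∀ b, s * K (blk x) b ≤ K' (blk x) b) : OutMajorant blk (s • T) S K' := by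
  intro y' μ B hμ x hxS
  rw [LinearMap.smul_apply, Pi.smul_apply, smul_eq_mul]
  by_cases hx : x ∈ W
  · rw [abs_mul, abs_of_nonneg hs]
    calc s * |T μ x| ≤ s * (K (blk x) y' * B) := mul_le_mul_of_nonneg_left (h y' μ B hμ x hxS) hs
      _ = s * K (blk x) y' * B := by ring
      _ ≤ K' (blk x) y' * B := mul_le_mul_of_nonneg_right (hle x hx hxS y') hμ.nonneg
  · rw [hW μ x hx, mul_zero, abs_zero]
    exact mul_nonneg (hK' _ _) hμ.nonneg

/-- a transplant vanishes off its window. [cite: Balaban1984PropagatorsII, p.238 (T_□ = □̃³), dictionary] -/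
theorem transplant_apply_of_not_mem {X' : Type} [DecidableEq X] [DecidableEq X'] (W : Finset X) (e : X → X') (T' : Module.End ℝ (X' → ℝ))
    (μ : X → ℝ) {x : X} (hx : x ∉ W) : transplant W e T' μ x = 0 := by
  rw [transplant_apply, if_neg hx]

end Out

/-! ## §2  The band arithmetic on one circle `ℤ/M`: for a label `q₁` of the middle band, `|q − q₁| ≤ C·|q − q₁|_{ℤ/M}` for EVERY label `q` -/

section Band

/-- off the centred range the circular distance is `M − |x|` (`|x| < M < 2|x|`). [folklore] -/
private theorem circAbs_eq_sub_of_large {M : ℕ} (hM : 1 ≤ M) {x : ℤ} (hxM : |x| < M) (hx : (M : ℤ) < 2 * |x|) : circAbs M x = M - |x| := by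
  rcases le_or_gt 0 x with h0 | h0
  · rw [abs_of_nonneg h0] at hxM hx ⊢
    have e : x = (x - M) + M * 1 := by ring
    rw [e, circAbs_add_mul, circAbs_of_centred hM (by rw [abs_of_nonpos (by linarith)]; linarith), abs_of_nonpos (by linarith)]
    ring
  · rw [abs_of_neg h0] at hxM hx ⊢
    have e : x = (x + M) + M * (-1) := by ring
    rw [e, circAbs_add_mul, circAbs_of_centred hM (by rw [abs_of_nonneg (by linarith)]; linarith), abs_of_nonneg (by linarith)]
    ring

/-- **THE BAND LEMMA**: for labels `q, q₁ ∈ [0, M)` with `q₁` in the middle band — `(C+1)(q₁+1) ≥ M` and `(C+1)q₁ ≤ C·M` — the flat distance is at most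
`C` times the circular one: `|q − q₁| ≤ C·|q − q₁|_{ℤ/M}` (`C ≥ 1`).  (Print: central inputs of `T_□ = □̃³`; here the window may be anchored anywhere.)
[cite: Balaban1984PropagatorsII, p.238 (□ ⊂ □̃³ = T_□), (2.133) p.247; derivation ours] -/
theorem abs_sub_le_mul_circAbs {M C : ℕ} (hC : 1 ≤ C) {q q₁ : ℤ} (hq : 0 ≤ q) (hqM : q < M) (hq₁ : 0 ≤ q₁) (hq₁M : q₁ < M)
    (hlo : (M : ℤ) ≤ (C + 1) * (q₁ + 1)) (hhi : ((C : ℤ) + 1) * q₁ ≤ C * M) : |q - q₁| ≤ C * circAbs M (q - q₁) := by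
  have hM : 1 ≤ M := by
    have : (0 : ℤ) < M := lt_of_le_of_lt hq hqM
    exact_mod_cast this
  have hC' : (1 : ℤ) ≤ C := by exact_mod_cast hC
  have hxM : |q - q₁| < M := by rw [abs_lt]; constructor <;> linarith
  by_cases hcen : 2 * |q - q₁| ≤ M
  · rw [circAbs_of_centred hM hcen]
    nlinarith [abs_nonneg (q - q₁)]
  · push Not at hcen
    rw [circAbs_eq_sub_of_large hM hxM hcen]
    -- `(C+1)|x| ≤ C·M`
    rcases le_or_gt 0 (q - q₁) with h0 | h0
    · rw [abs_of_nonneg h0]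
      nlinarith
    · rw [abs_of_neg h0]
      nlinarith

end Band

/-! ## §3  On the member torus `T_□`: the flat sup-distance of two window points against the torus distance of their `j`-blocks, the input point
in the middle band, the output point ANYWHERE in the fundamental domain -/

section LocalTorus

open B5Eq118OneStroke (iterBlockOf)
open B6LowerBound2153Torus (rep)
open B5Eq117TorusCarriers (Mk)
open B6Prop25TwoScaleCensus (TSIdx)

variable {d L : ℕ} {hd : 1 ≤ d + 1} {hL : Odd L ∧ 1 < L} {a₀ a₁ : ℝ} (i : TSIdx d L hd hL a₀ a₁)

/-- floor division by `n > 0` is `n`-Lipschitz up to the remainder: `|a − b| ≤ n·|⌊a/n⌋ − ⌊b/n⌋| + (n − 1)`. [folklore] -/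
private theorem abs_sub_le_mul_abs_ediv_sub (n : ℤ) (hn : 0 < n) (a b : ℤ) : |a - b| ≤ n * |a / n - b / n| + (n - 1) := by
  have ha := Int.emod_def a n
  have hb := Int.emod_def b n
  have hra0 := Int.emod_nonneg a hn.ne'
  have hrb0 := Int.emod_nonneg b hn.ne'
  have hra := Int.emod_lt_of_pos a hn
  have hrb := Int.emod_lt_of_pos b hn
  have hsplit : a - b = n * (a / n - b / n) + (a % n - b % n) := by
    rw [mul_sub]
    linarith
  have hr : |a % n - b % n| ≤ n - 1 := by
    rw [abs_le]
    constructor <;> linarith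
  calc |a - b| = |n * (a / n - b / n) + (a % n - b % n)| := by rw [hsplit]
    _ ≤ |n * (a / n - b / n)| + |a % n - b % n| := abs_add_le _ _
    _ ≤ n * |a / n - b / n| + (n - 1) := by
        rw [abs_mul, abs_of_pos hn]
        linarith

/-- labels of points of the fundamental domain lie in `[0, M_j)`, `M_j = 2L^{m+K−j}` the label period: `0 ≤ ⌊z/L^j⌋ < M_j` for `0 ≤ z < 2L^{m+K}`. [folklore] -/
private theorem ediv_period {z : ℤ} (hz0 : 0 ≤ z) (hzN : z < (i.P.sitesPerDir 0 : ℕ)) :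
    0 ≤ z / ((L ^ i.j : ℕ) : ℤ) ∧ z / ((L ^ i.j : ℕ) : ℤ) < ((i.P.sitesPerDir i.j : ℕ) : ℤ) := by
  have hL0 : 0 < L := by have := hL.2; omega
  have hn : (0 : ℤ) < ((L ^ i.j : ℕ) : ℤ) := by positivity
  refine ⟨Int.ediv_nonneg hz0 hn.le, Int.ediv_lt_of_lt_mul hn ?_⟩
  have hpow : ((i.P.sitesPerDir 0 : ℕ) : ℤ) = ((i.P.sitesPerDir i.j : ℕ) : ℤ) * ((L ^ i.j : ℕ) : ℤ) := by
    rw [sitesPerDir_zero, sitesPerDir_j, ← Nat.cast_mul, mul_assoc, ← pow_add, Nat.sub_add_cancel (Nat.le_of_succ_le i.hjP)]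
  rw [← hpow]
  exact hzN

/-- **FLAT DISTANCE AGAINST TORUS DISTANCE, ONE END IN THE BAND**: for points `z, z₁` of the fundamental domain `[0, 2L^{m+K})^{d+1}` of `T_□` whose
INPUT point `z₁` has its `j`-labels in the middle band (`(C+1)(⌊z₁/L^j⌋ + 1) ≥ M_j`, `(C+1)⌊z₁/L^j⌋ ≤ C·M_j`), and the OUTPUT point `z` anywhere:
`|z − z₁|_∞ ≤ L^j·C·|y(z) − y(z₁)|_T + (L^j − 1)`. [cite: Balaban1984PropagatorsII, p.238 (T_□ = □̃³), (2.133) p.247 («|y − y′|» on T_□); derivation ours] -/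
theorem supNorm_sub_le_tdist_band {C : ℕ} (hC : 1 ≤ C) {z z₁ : Fin (d + 1) → ℤ} (hz0 : ∀ μ, 0 ≤ z μ) (hz₁0 : ∀ μ, 0 ≤ z₁ μ)
    (hzN : ∀ μ, z μ < (i.P.sitesPerDir 0 : ℕ)) (hz₁N : ∀ μ, z₁ μ < (i.P.sitesPerDir 0 : ℕ))
    (hlo : ∀ μ, ((i.P.sitesPerDir i.j : ℕ) : ℤ) ≤ (C + 1) * (z₁ μ / ((L ^ i.j : ℕ) : ℤ) + 1))
    (hhi : ∀ μ, ((C : ℤ) + 1) * (z₁ μ / ((L ^ i.j : ℕ) : ℤ)) ≤ C * ((i.P.sitesPerDir i.j : ℕ) : ℤ)) :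
    supNorm (z - z₁) ≤ ((L ^ i.j : ℕ) : ℝ) * (C * i.tdist (iterBlockOf i.j (siteOfInt i z)) (iterBlockOf i.j (siteOfInt i z₁))) +
      (((L ^ i.j : ℕ) : ℝ) - 1) := by
  have hL0 : 0 < L := by have := hL.2; omega
  have hn : (0 : ℤ) < ((L ^ i.j : ℕ) : ℤ) := by positivity
  set q : Fin (d + 1) → ℤ := rep (Mk i.P i.j) (iterBlockOf i.j (siteOfInt i z)) with hqdef
  set q₁ : Fin (d + 1) → ℤ := rep (Mk i.P i.j) (iterBlockOf i.j (siteOfInt i z₁)) with hq₁def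
  have hq : ∀ μ, q μ = z μ / ((L ^ i.j : ℕ) : ℤ) := fun μ => rep_iterBlockOf_siteOfInt i hz0 hzN μ
  have hq₁ : ∀ μ, q₁ μ = z₁ μ / ((L ^ i.j : ℕ) : ℤ) := fun μ => rep_iterBlockOf_siteOfInt i hz₁0 hz₁N μ
  have hMk : ∀ μ, (Mk i.P i.j μ : ℤ) = ((i.P.sitesPerDir i.j : ℕ) : ℤ) := fun μ => rfl
  -- per coordinate: the band lemma
  have hcoord : ∀ μ, |(q - q₁) μ| ≤ C * circAbs (Mk i.P i.j μ) ((q - q₁) μ) := by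
    intro μ
    rw [Pi.sub_apply, hq μ, hq₁ μ]
    obtain ⟨ha0, ha⟩ := ediv_period i (hz0 μ) (hzN μ)
    obtain ⟨hb0, hb⟩ := ediv_period i (hz₁0 μ) (hz₁N μ)
    have h := abs_sub_le_mul_circAbs (M := i.P.sitesPerDir i.j) hC ha0 ha hb0 hb (hlo μ) (hhi μ)
    exact h
  have htd : i.tdist (iterBlockOf i.j (siteOfInt i z)) (iterBlockOf i.j (siteOfInt i z₁)) = torusSupNorm (Mk i.P i.j) (q - q₁) := rfl
  rw [htd]
  have hnR : (0 : ℝ) ≤ ((L ^ i.j : ℕ) : ℝ) := by positivity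
  have hCR : (0 : ℝ) ≤ (C : ℝ) := Nat.cast_nonneg _
  unfold supNorm
  refine Finset.sup'_le _ _ fun μ _ => ?_
  have hμ : (((circAbs (Mk i.P i.j μ) ((q - q₁) μ)) : ℤ) : ℝ) ≤ torusSupNorm (Mk i.P i.j) (q - q₁) :=
    Finset.le_sup' (fun ν => ((circAbs (Mk i.P i.j ν) ((q - q₁) ν) : ℤ) : ℝ)) (Finset.mem_univ μ)
  have hint : |(z - z₁) μ| ≤ ((L ^ i.j : ℕ) : ℤ) * |(q - q₁) μ| + (((L ^ i.j : ℕ) : ℤ) - 1) := by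
    rw [Pi.sub_apply, Pi.sub_apply, hq μ, hq₁ μ]
    exact abs_sub_le_mul_abs_ediv_sub _ hn _ _
  have hint2 : |(z - z₁) μ| ≤ ((L ^ i.j : ℕ) : ℤ) * (C * circAbs (Mk i.P i.j μ) ((q - q₁) μ)) + (((L ^ i.j : ℕ) : ℤ) - 1) := by
    have := mul_le_mul_of_nonneg_left (hcoord μ) hn.le
    linarith
  have hcast : ((|(z - z₁) μ| : ℤ) : ℝ) ≤ ((L ^ i.j : ℕ) : ℝ) * (C * (((circAbs (Mk i.P i.j μ) ((q - q₁) μ)) : ℤ) : ℝ)) + (((L ^ i.j : ℕ) : ℝ) - 1) := by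
    have := (Int.cast_le (R := ℝ)).mpr hint2
    push_cast at this ⊢
    exact this
  nlinarith [mul_le_mul_of_nonneg_left (mul_le_mul_of_nonneg_left hμ hCR) hnR]

end LocalTorus

/-! ## §4  The generic bridges: a member operator with a (2.133)-shape majorant on `T_□`, transplanted through a window chart (possibly the full
fundamental domain), has an INPUT-localised (resp. OUTPUT-localised) majorant with GLOBAL decay when the inputs (resp. outputs) sit in the band -/

section Bridge

open B5Eq118OneStroke (iterBlockOf)
open B6Prop25TwoScaleCensus (TSIdx)
open B6Ineq2133TwoScaleV1 (tsGeo tsGeo_dist_comm)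

variable {X X' : Type}

/-- **TRANSPORT OF A MAJORANT THROUGH A CHART, OUTPUTS OVER `S`, INPUTS ANYWHERE** (the transposed twin of
`B6InMajorantTransplant.inMajorant_transplant`): kernel comparison asked for window outputs over `S` against ALL window inputs; fibre bound for every
global block. [cite: Balaban1984PropagatorsII, (2.133) p.247, (2.90)–(2.91) p.239; derivation ours] -/
theorem outMajorant_transplant [DecidableEq X'] [DecidableEq X] {W : Finset X} {e : X → X'} {g g' : B6.Geometry} (blk : X → g.Site)
    (blk' : X' → g'.Site) (S : Set g.Site) (hinj : Set.InjOn e ↑W) {T' : Module.End ℝ (X' → ℝ)} {K' : g'.Site → g'.Site → ℝ}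
    (hT' : HasMajorant blk' T' K') (K : g.Site → g.Site → ℝ) (hK : ∀ a b, 0 ≤ K a b)
    (hcomp : ∀ x ∈ W, blk x ∈ S → ∀ x₁ ∈ W, K' (blk' (e x)) (blk' (e x₁)) ≤ K (blk x) (blk x₁))
    (n : ℕ) (hfib : ∀ y, ∃ T : Finset g'.Site, T.card ≤ n ∧ ∀ x ∈ W, blk x = y → blk' (e x) ∈ T) :
    OutMajorant blk (transplant W e T') S (fun a b => n * K a b) := by
  classical
  intro y' μ B hμ x hxS
  obtain ⟨T, hTn, hT⟩ := hfib y'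
  have hB : 0 ≤ B := hμ.nonneg
  have hnKB : 0 ≤ (n : ℝ) * K (blk x) y' * B := mul_nonneg (mul_nonneg (Nat.cast_nonneg _) (hK _ _)) hB
  rw [transplant_apply]
  by_cases hxW : x ∈ W
  swap
  · rw [if_neg hxW, abs_zero]
    exact hnKB
  rw [if_pos hxW]
  set ν : X' → ℝ := restrictOp W e μ with hν
  set F : Finset g'.Site := (W.filter (fun x => blk x = y')).image (fun x => blk' (e x)) with hF
  have hAx : ∀ x', |ν x'| ≤ B ∧ (ν x' ≠ 0 → blk' x' ∈ F) := by
    intro x'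
    by_cases hex : ∃ x₁ ∈ W, e x₁ = x'
    · obtain ⟨x₁, hx₁, rfl⟩ := hex
      rw [hν, restrictOp_apply_of_injOn hinj μ hx₁]
      by_cases hb : blk x₁ = y'
      · refine ⟨hμ.bound x₁ hb, fun _ => ?_⟩
        rw [hF, Finset.mem_image]
        exact ⟨x₁, Finset.mem_filter.mpr ⟨hx₁, hb⟩, rfl⟩
      · rw [hμ.off x₁ hb, abs_zero]
        exact ⟨hB, fun h => absurd rfl h⟩
    · push Not at hex
      rw [hν, restrictOp_apply_of_not_mem μ hex, abs_zero]
      exact ⟨hB, fun h => absurd rfl h⟩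
  have hBsum : ν = ∑ b ∈ F, blockPiece blk' b ν := by
    have hsub : ∑ b ∈ F, blockPiece blk' b ν = ∑ b, blockPiece blk' b ν := by
      refine Finset.sum_subset (Finset.subset_univ F) fun b _ hbF => ?_
      funext x'
      simp only [blockPiece, Pi.zero_apply]
      split_ifs with hbx
      · by_contra hne
        exact hbF (hbx ▸ (hAx x').2 hne)
      · rfl
    rw [hsub, sum_blockPiece]
  have hpiece : ∀ b ∈ F, |T' (blockPiece blk' b ν) (e x)| ≤ K (blk x) y' * B := by
    intro b hb
    have hsupp : BlockSupp blk' (blockPiece blk' b ν) b B := blockSupp_blockPiece blk' ν b B hB fun x' _ => (hAx x').1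
    refine (hT' b _ B hsupp (e x)).trans (mul_le_mul_of_nonneg_right ?_ hB)
    obtain ⟨x₁, hx₁, rfl⟩ := Finset.mem_image.mp hb
    obtain ⟨hx₁W, hbx₁⟩ := Finset.mem_filter.mp hx₁
    have h := hcomp x hxW hxS x₁ hx₁W
    rwa [hbx₁] at h
  calc |T' ν (e x)| = |(∑ b ∈ F, T' (blockPiece blk' b ν)) (e x)| := by
          conv_lhs => rw [hBsum]
          rw [map_sum]
    _ = |∑ b ∈ F, T' (blockPiece blk' b ν) (e x)| := by rw [Finset.sum_apply]
    _ ≤ ∑ b ∈ F, |T' (blockPiece blk' b ν) (e x)| := Finset.abs_sum_le_sum_abs _ _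
    _ ≤ ∑ b ∈ F, K (blk x) y' * B := Finset.sum_le_sum hpiece
    _ = F.card * (K (blk x) y' * B) := by rw [Finset.sum_const, nsmul_eq_mul]
    _ ≤ n * (K (blk x) y' * B) := by
          refine mul_le_mul_of_nonneg_right (Nat.cast_le.mpr ?_) (mul_nonneg (hK _ _) hB)
          have hFT : F ⊆ T := by
            intro b hb
            obtain ⟨x₁, hx₁, rfl⟩ := Finset.mem_image.mp hb
            obtain ⟨hx₁W, hbx₁⟩ := Finset.mem_filter.mp hx₁
            exact hT x₁ hx₁W hbx₁
          exact (Finset.card_le_card hFT).trans hTn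
    _ = n * K (blk x) y' * B := by ring

variable {d L : ℕ} {hd : 1 ≤ d + 1} {hL : Odd L ∧ 1 < L} {a₀ a₁ : ℝ} (i : TSIdx d L hd hL a₀ a₁)

/-- the window points have non-negative relative labels below the period. [cite: Balaban1984PropagatorsII, p.238 (T_□), bookkeeping] -/
theorem rel_window {pos : X → Fin (d + 1) → ℤ} {x₀ : Fin (d + 1) → ℤ} {Wd : ℕ} (hWd : Wd ≤ i.P.sitesPerDir 0) {W : Finset X}
    (hW : ∀ x ∈ W, InWindow pos x₀ Wd x) {x : X} (hx : x ∈ W) :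
    (∀ μ, 0 ≤ pos x μ - x₀ μ) ∧ ∀ μ, pos x μ - x₀ μ < (i.P.sitesPerDir 0 : ℕ) := by
  refine ⟨fun μ => by have := (hW x hx μ).1; linarith, fun μ => ?_⟩
  have := (hW x hx μ).2
  have hc : ((Wd : ℕ) : ℤ) ≤ ((i.P.sitesPerDir 0 : ℕ) : ℤ) := by exact_mod_cast hWd
  linarith

/-- the sup norm is even. [folklore] -/
private theorem supNorm_neg (x : Fin (d + 1) → ℤ) : supNorm (-x) = supNorm x := by
  unfold B4ContourShift.supNorm
  congr 1
  funext μ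
  simp

/-- **`|pos x − pos x₁|_∞/L^j ≤ C·|y(x) − y(x₁)|_{T_□} + 1` WHEN THE INPUT `x₁` IS IN THE BAND** (both points in the window).
[cite: Balaban1984PropagatorsII, p.238 (T_□ = □̃³), (2.133) p.247; derivation ours] -/
theorem supNorm_div_le_of_band_right (R M : ℝ) (pos : X → Fin (d + 1) → ℤ) (dir : X → Fin (d + 1)) (x₀ : Fin (d + 1) → ℤ) {Wd : ℕ}
    (hWd : Wd ≤ i.P.sitesPerDir 0) (W : Finset X) (hW : ∀ x ∈ W, InWindow pos x₀ Wd x) {C : ℕ} (hC : 1 ≤ C) {x x₁ : X} (hx : x ∈ W) (hx₁ : x₁ ∈ W)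
    (hband : ∀ μ, ((i.P.sitesPerDir i.j : ℕ) : ℤ) ≤ (C + 1) * ((pos x₁ μ - x₀ μ) / ((L ^ i.j : ℕ) : ℤ) + 1) ∧
      ((C : ℤ) + 1) * ((pos x₁ μ - x₀ μ) / ((L ^ i.j : ℕ) : ℤ)) ≤ C * ((i.P.sitesPerDir i.j : ℕ) : ℤ)) :
    supNorm (pos x - pos x₁) / ((L ^ i.j : ℕ) : ℝ) ≤
      C * (tsGeo i R M).dist (iterBlockOf i.j (chartBond i pos dir x₀ x).src) (iterBlockOf i.j (chartBond i pos dir x₀ x₁).src) + 1 := by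
  have hL0 : 0 < L := by have := hL.2; omega
  have hnpos : (0 : ℝ) < ((L ^ i.j : ℕ) : ℝ) := by positivity
  have hsup := supNorm_sub_le_tdist_band i hC (rel_window i hWd hW hx).1 (rel_window i hWd hW hx₁).1 (rel_window i hWd hW hx).2
    (rel_window i hWd hW hx₁).2 (fun μ => (hband μ).1) (fun μ => (hband μ).2)
  have hsub : (fun μ => pos x μ - x₀ μ) - (fun μ => pos x₁ μ - x₀ μ) = pos x - pos x₁ := by
    funext μ
    simp only [Pi.sub_apply]
    ring
  rw [hsub] at hsup
  simp only [chartBond_src]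
  show _ ≤ C * i.tdist _ _ + 1
  set t := i.tdist (iterBlockOf i.j (siteOfInt i fun μ => pos x μ - x₀ μ)) (iterBlockOf i.j (siteOfInt i fun μ => pos x₁ μ - x₀ μ)) with ht
  have htn : 0 ≤ t := i.tdist_nonneg _ _
  have hCR : (0 : ℝ) ≤ (C : ℝ) := Nat.cast_nonneg _
  rw [div_le_iff₀ hnpos]
  nlinarith [mul_nonneg hCR htn]

/-- **THE SAME WHEN THE OUTPUT `x` IS IN THE BAND** (the sup norm and the torus distance are symmetric).
[cite: Balaban1984PropagatorsII, p.238 (T_□ = □̃³), (2.133) p.247; derivation ours] -/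
theorem supNorm_div_le_of_band_left (R M : ℝ) (pos : X → Fin (d + 1) → ℤ) (dir : X → Fin (d + 1)) (x₀ : Fin (d + 1) → ℤ) {Wd : ℕ}
    (hWd : Wd ≤ i.P.sitesPerDir 0) (W : Finset X) (hW : ∀ x ∈ W, InWindow pos x₀ Wd x) {C : ℕ} (hC : 1 ≤ C) {x x₁ : X} (hx : x ∈ W) (hx₁ : x₁ ∈ W)
    (hband : ∀ μ, ((i.P.sitesPerDir i.j : ℕ) : ℤ) ≤ (C + 1) * ((pos x μ - x₀ μ) / ((L ^ i.j : ℕ) : ℤ) + 1) ∧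
      ((C : ℤ) + 1) * ((pos x μ - x₀ μ) / ((L ^ i.j : ℕ) : ℤ)) ≤ C * ((i.P.sitesPerDir i.j : ℕ) : ℤ)) :
    supNorm (pos x - pos x₁) / ((L ^ i.j : ℕ) : ℝ) ≤
      C * (tsGeo i R M).dist (iterBlockOf i.j (chartBond i pos dir x₀ x).src) (iterBlockOf i.j (chartBond i pos dir x₀ x₁).src) + 1 := by
  have h := supNorm_div_le_of_band_right i R M pos dir x₀ hWd W hW hC hx₁ hx hband
  rw [tsGeo_dist_comm i R M, ← neg_sub, supNorm_neg] at h
  exact h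

/-- **THE KERNEL COMPARISON**: `|·|_∞/L^j ≤ C t + 1` and `d(y(x), y(x₁)) ≤ κ·|·|_∞/L^j + c` give
`A·e^{−δt} ≤ A·e^{δ(κ+c)/(κC)}·e^{−(δ/(κC))·d}`. [cite: Balaban1984PropagatorsII, (2.133)–(2.134) p.247; derivation ours] -/
theorem expKernel_of_supNorm_le {g : B6.Geometry} {a b : g.Site} {A δ κ c s t : ℝ} (hA : 0 ≤ A) (hδ : 0 ≤ δ) {C : ℕ} (hC : 1 ≤ C) (hκ : 0 < κ)
    (hs : s ≤ C * t + 1) (hglob : g.dist a b ≤ κ * s + c) :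
    A * Real.exp (-(δ * t)) ≤ A * Real.exp (δ * (κ + c) / (κ * C)) * Real.exp (-(δ / (κ * C) * g.dist a b)) := by
  have hCpos : (0 : ℝ) < (C : ℝ) := by exact_mod_cast hC
  have hdist : g.dist a b ≤ κ * C * t + (κ + c) := by nlinarith [mul_le_mul_of_nonneg_left hs hκ.le]
  exact expKernel_le_of_dist_le hA hδ (mul_pos hκ hCpos) hdist

/-- **THE BAND BRIDGE, INPUT-LOCALISED FORM**: let `T′` on the bond functions of `T_□` have the majorant `A·e^{−δ|y−y′|_{T_□}}` (`j`-blocks), let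
the window `W` (side `≤` the fine period, e.g. the whole fundamental domain `□̃³`) be charted injectively, let the global block distance be controlled
by the flat distance on `W`, at most `n` charted blocks over a global block of `S`, and let every window bond with block in `S` have its labels in the
middle band.  Then `ε T′ ρ` has the INPUT-localised majorant `n·A·e^{δ(κ+c)/(κC)}·e^{−(δ/(κC))·d}` over `S`, outputs ANYWHERE.
[cite: Balaban1984PropagatorsII, (2.133)–(2.134) p.247, (2.90)–(2.91) p.239, p.238 (T_□ = □̃³); derivation ours] -/
theorem inMajorant_transplant_of_band (R M : ℝ) [DecidableEq X] {g : B6.Geometry}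
    (blk : X → g.Site) (S : Set g.Site) (pos : X → Fin (d + 1) → ℤ) (dir : X → Fin (d + 1)) (x₀ : Fin (d + 1) → ℤ)
    {Wd : ℕ} (hWd : Wd ≤ i.P.sitesPerDir 0) (W : Finset X) (hW : ∀ x ∈ W, InWindow pos x₀ Wd x)
    (hinj : Set.InjOn (fun x => (pos x, dir x)) ↑W)
    {T' : Module.End ℝ (PBond i.P 0 → ℝ)} {A δ : ℝ} (hA : 0 ≤ A) (hδ : 0 ≤ δ)
    (hT' : HasMajorant (g := tsGeo i R M) (fun b : PBond i.P 0 => iterBlockOf i.j b.src) T' (fun y y' => A * Real.exp (-(δ * i.tdist y y'))))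
    {C : ℕ} (hC : 1 ≤ C)
    (hband : ∀ x ∈ W, blk x ∈ S → ∀ μ, ((i.P.sitesPerDir i.j : ℕ) : ℤ) ≤ (C + 1) * ((pos x μ - x₀ μ) / ((L ^ i.j : ℕ) : ℤ) + 1) ∧
      ((C : ℤ) + 1) * ((pos x μ - x₀ μ) / ((L ^ i.j : ℕ) : ℤ)) ≤ C * ((i.P.sitesPerDir i.j : ℕ) : ℤ))
    (κ c : ℝ) (hκ : 0 < κ)
    (hglob : ∀ x ∈ W, ∀ x₁ ∈ W, g.dist (blk x) (blk x₁) ≤ κ * (supNorm (pos x - pos x₁) / ((L ^ i.j : ℕ) : ℝ)) + c)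
    (n : ℕ) (hfib : ∀ y ∈ S, ∃ T : Finset (Site i.P i.j), T.card ≤ n ∧
      ∀ x ∈ W, blk x = y → iterBlockOf i.j (chartBond i pos dir x₀ x).src ∈ T) :
    InMajorant blk (transplant W (chartBond i pos dir x₀) T') S
      (fun a b => n * ((A * Real.exp (δ * (κ + c) / (κ * C))) * Real.exp (-(δ / (κ * C) * g.dist a b)))) := by
  classical
  refine inMajorant_transplant (g' := tsGeo i R M) blk (fun b : PBond i.P 0 => iterBlockOf i.j b.src) S
    (injOn_chartBond_full i pos dir x₀ hWd W hW hinj) hT' _ (fun a b => by positivity) (fun x hx x₁ hx₁ hx₁S => ?_) n hfib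
  exact expKernel_of_supNorm_le hA hδ hC hκ
    (supNorm_div_le_of_band_right i R M pos dir x₀ hWd W hW hC hx hx₁ (hband x₁ hx₁ hx₁S)) (hglob x hx x₁ hx₁)

/-- **THE BAND BRIDGE, OUTPUT-LOCALISED FORM**: the same with the OUTPUT bonds over `S` in the band and the inputs anywhere (fibre bound for every
global block). [cite: Balaban1984PropagatorsII, (2.133)–(2.134) p.247, (2.90)–(2.91) p.239, p.238 (T_□ = □̃³); derivation ours] -/
theorem outMajorant_transplant_of_band (R M : ℝ) [DecidableEq X] {g : B6.Geometry}
    (blk : X → g.Site) (S : Set g.Site) (pos : X → Fin (d + 1) → ℤ) (dir : X → Fin (d + 1)) (x₀ : Fin (d + 1) → ℤ)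
    {Wd : ℕ} (hWd : Wd ≤ i.P.sitesPerDir 0) (W : Finset X) (hW : ∀ x ∈ W, InWindow pos x₀ Wd x)
    (hinj : Set.InjOn (fun x => (pos x, dir x)) ↑W)
    {T' : Module.End ℝ (PBond i.P 0 → ℝ)} {A δ : ℝ} (hA : 0 ≤ A) (hδ : 0 ≤ δ)
    (hT' : HasMajorant (g := tsGeo i R M) (fun b : PBond i.P 0 => iterBlockOf i.j b.src) T' (fun y y' => A * Real.exp (-(δ * i.tdist y y'))))
    {C : ℕ} (hC : 1 ≤ C)
    (hband : ∀ x ∈ W, blk x ∈ S → ∀ μ, ((i.P.sitesPerDir i.j : ℕ) : ℤ) ≤ (C + 1) * ((pos x μ - x₀ μ) / ((L ^ i.j : ℕ) : ℤ) + 1) ∧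
      ((C : ℤ) + 1) * ((pos x μ - x₀ μ) / ((L ^ i.j : ℕ) : ℤ)) ≤ C * ((i.P.sitesPerDir i.j : ℕ) : ℤ))
    (κ c : ℝ) (hκ : 0 < κ)
    (hglob : ∀ x ∈ W, ∀ x₁ ∈ W, g.dist (blk x) (blk x₁) ≤ κ * (supNorm (pos x - pos x₁) / ((L ^ i.j : ℕ) : ℝ)) + c)
    (n : ℕ) (hfib : ∀ y, ∃ T : Finset (Site i.P i.j), T.card ≤ n ∧
      ∀ x ∈ W, blk x = y → iterBlockOf i.j (chartBond i pos dir x₀ x).src ∈ T) :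
    OutMajorant blk (transplant W (chartBond i pos dir x₀) T') S
      (fun a b => n * ((A * Real.exp (δ * (κ + c) / (κ * C))) * Real.exp (-(δ / (κ * C) * g.dist a b)))) := by
  classical
  refine outMajorant_transplant (g' := tsGeo i R M) blk (fun b : PBond i.P 0 => iterBlockOf i.j b.src) S
    (injOn_chartBond_full i pos dir x₀ hWd W hW hinj) hT' _ (fun a b => by positivity) (fun x hx hxS x₁ hx₁ => ?_) n hfib
  exact expKernel_of_supNorm_le hA hδ hC hκ
    (supNorm_div_le_of_band_left i R M pos dir x₀ hWd W hW hC hx hx₁ (hband x hx hxS)) (hglob x hx x₁ hx₁)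

end Bridge

/-! ## §5  FIRED ON THE V1 GLOBAL TORUS `T_η` (p21's torus family `D`, geometry `geomT D`, block map `blkV1`; r03's full bond window `cB t x₀`):
a member operator with a (2.133)-shape majorant on `T_□`, transplanted through the FULL window, has input- and output-localised majorants with global decay
over any reach whose bonds sit in the middle band of the window -/

section V1

open B5Eq118OneStroke (iterBlockOf)
open B6LowerBound2153Torus (rep)
open B5Eq117TorusCarriers (Mk)
open B6Prop25TwoScaleCensus (TSIdx)
open B6Ineq2133TwoScaleV1 (tsGeo)
open B6GlobalChartV1 (PV toBox toBox_apply blkV1)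
open B6MultiLevelBoxOperator (Domains N0)
open B6MultiLevelTorusOperator (TDomains)
open B6Geom246MultiLevelBox (bset blkOf geom bond coord_bounds lev_eq_of_blkOf_eq)
open B6Geom246MultiLevelTorus (geomT bondT distT_le_dist_box)
open B4Reflection242 (boxDom)
open B6AgreeLapV1Chart (cB eB posV mem_cB_W transplant_eB_eq)
open B6Prop26ReachTransplant (hglob_sites)

variable {d ℓ : ℕ} {hd : 1 ≤ d + 1} {hL : Odd (ℓ + 1) ∧ 1 < ℓ + 1} {a₀ a₁ : ℝ} {m K : ℕ} (t : TSIdx d (ℓ + 1) hd hL a₀ a₁)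

/-- a site of `T^{(j)}` is determined by its labels. [folklore] -/
private theorem rep_injective : Function.Injective (rep (Mk t.P t.j) : Site t.P t.j → Fin (d + 1) → ℤ) := by
  intro y y' h
  funext μ
  have hμ := congrFun h μ
  simp only [rep, Nat.cast_inj] at hμ
  exact ZMod.val_injective _ hμ

/-- **THE FIBRE INPUT FOR A WINDOW UP TO THE FULL PERIOD**: `≤ L^{d+1}` charted `j`-blocks over a global block of level `j` or `j + 1` meeting the
window (corner in `L^jℤ^{d+1}`; `B6Prop26ReachTransplant.hfib_sites` with the side bound relaxed from the half to the full fine period of `T_□`).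
[cite: Balaban1984PropagatorsII, (2.1) p.224, (2.89) p.239, p.238 (T_□ = □̃³); Balaban1984PropagatorsI, (1.16)–(1.18) p.20] -/
theorem hfib_sites_full {Mh k R : ℕ} {P : Fin (d + 1) → ℕ} (D : Domains d ℓ Mh k P R) {X : Type}
    (site : X → ↥(boxDom (N0 ℓ Mh k P))) (dir : X → Fin (d + 1)) (x₀ : Fin (d + 1) → ℤ)
    (hx₀ : ∀ μ, (((ℓ + 1) ^ t.j : ℕ) : ℤ) ∣ x₀ μ) (Wd : ℕ) (hWd : Wd ≤ t.P.sitesPerDir 0)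
    (hlev : ∀ z ∈ boxDom (N0 ℓ Mh k P), (∀ μ, x₀ μ ≤ z μ ∧ z μ < x₀ μ + Wd) → t.j ≤ D.lev z ∧ D.lev z ≤ t.j + 1)
    (W : Finset X) (hW : ∀ x ∈ W, InWindow (fun x => (site x : Fin (d + 1) → ℤ)) x₀ Wd x) (y : ↥(bset D)) :
    ∃ T : Finset (Site t.P t.j), T.card ≤ (ℓ + 1) ^ (d + 1) ∧ ∀ x ∈ W, blkOf D (site x) = y → iterBlockOf t.j
      (chartBond t (fun x => (site x : Fin (d + 1) → ℤ)) dir x₀ x).src ∈ T := by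
  classical
  set F := (W.filter (fun x => blkOf D (site x) = y)).image (fun x => iterBlockOf t.j
      (chartBond t (fun x => (site x : Fin (d + 1) → ℤ)) dir x₀ x).src) with hF
  have hmemF : ∀ x ∈ W, blkOf D (site x) = y → iterBlockOf t.j
      (chartBond t (fun x => (site x : Fin (d + 1) → ℤ)) dir x₀ x).src ∈ F := fun x hx hxy =>
    Finset.mem_image.mpr ⟨x, Finset.mem_filter.mpr ⟨hx, hxy⟩, rfl⟩
  refine ⟨F, ?_, hmemF⟩
  by_cases hne : (W.filter (fun x => blkOf D (site x) = y)) = ∅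
  · rw [hF, hne, Finset.image_empty, Finset.card_empty]
    exact Nat.zero_le _
  obtain ⟨b₀, hb₀⟩ := Finset.nonempty_iff_ne_empty.mpr hne
  obtain ⟨hb₀W, hb₀y⟩ := Finset.mem_filter.mp hb₀
  set tl := y.1.1 with ht
  have hwin₀ := hW b₀ hb₀W
  have htlev : D.lev (site b₀ : Fin (d + 1) → ℤ) = tl := lev_eq_of_blkOf_eq D hb₀y
  have ht_range : t.j ≤ tl ∧ tl ≤ t.j + 1 := by
    rw [← htlev]
    exact hlev _ (site b₀).2 hwin₀
  have hL1 : 1 ≤ ℓ + 1 := by omega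
  have hLpos : (0 : ℤ) < (((ℓ + 1) ^ t.j : ℕ) : ℤ) := by positivity
  have hdvd : ∀ μ, (((ℓ + 1) ^ t.j : ℕ) : ℤ) ∣ (((ℓ + 1) ^ tl : ℕ) : ℤ) * y.1.2 μ - x₀ μ := fun μ =>
    dvd_sub (dvd_mul_of_dvd_left (by exact_mod_cast pow_dvd_pow (ℓ + 1) ht_range.1) _) (hx₀ μ)
  set a : Fin (d + 1) → ℤ := fun μ => ((((ℓ + 1) ^ tl : ℕ) : ℤ) * y.1.2 μ - x₀ μ) / (((ℓ + 1) ^ t.j : ℕ) : ℤ) with ha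
  set B : Finset (Fin (d + 1) → ℤ) := Fintype.piFinset fun μ => Finset.Ico (a μ) (a μ + (ℓ + 1 : ℕ)) with hB
  have hBcard : B.card = (ℓ + 1) ^ (d + 1) := by
    rw [hB, Fintype.card_piFinset]
    simp only [Int.card_Ico, add_sub_cancel_left, Int.toNat_natCast, Finset.prod_const, Finset.card_univ,
      Fintype.card_fin]
  have hinto : ∀ s ∈ F, rep (Mk t.P t.j) s ∈ B := by
    intro s hs
    obtain ⟨b, hb, rfl⟩ := Finset.mem_image.mp hs
    obtain ⟨hbW, hby⟩ := Finset.mem_filter.mp hb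
    have hwin := hW b hbW
    have hz0 : ∀ μ, 0 ≤ (site b : Fin (d + 1) → ℤ) μ - x₀ μ := fun μ => by have := (hwin μ).1; linarith
    have hzN : ∀ μ, (site b : Fin (d + 1) → ℤ) μ - x₀ μ < (t.P.sitesPerDir 0 : ℕ) := fun μ => by
      have := (hwin μ).2
      have hc : ((Wd : ℕ) : ℤ) ≤ ((t.P.sitesPerDir 0 : ℕ) : ℤ) := by exact_mod_cast hWd
      linarith
    rw [hB, Fintype.mem_piFinset]
    intro μ
    rw [Finset.mem_Ico, chartBond_src, rep_iterBlockOf_siteOfInt t hz0 hzN μ]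
    obtain ⟨hlo, hhi⟩ := coord_bounds D hby μ
    have hlo' : (((ℓ + 1) ^ tl : ℕ) : ℤ) * y.1.2 μ - x₀ μ ≤ (site b : Fin (d + 1) → ℤ) μ - x₀ μ := by
      have : (((ℓ + 1) ^ y.1.1 : ℕ) : ℤ) = (((ℓ + 1) ^ tl : ℕ) : ℤ) := by rw [ht]
      linarith
    constructor
    · exact Int.ediv_le_ediv hLpos hlo'
    · refine Int.ediv_lt_of_lt_mul hLpos ?_
      have hmul : a μ * (((ℓ + 1) ^ t.j : ℕ) : ℤ) = (((ℓ + 1) ^ tl : ℕ) : ℤ) * y.1.2 μ - x₀ μ :=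
        Int.ediv_mul_cancel (hdvd μ)
      have hpow : (((ℓ + 1) ^ tl : ℕ) : ℤ) ≤ ((ℓ + 1 : ℕ) : ℤ) * (((ℓ + 1) ^ t.j : ℕ) : ℤ) := by
        rw [← Nat.cast_mul, ← pow_succ']
        exact_mod_cast Nat.pow_le_pow_right hL1 ht_range.2
      have hhi' : (site b : Fin (d + 1) → ℤ) μ < (((ℓ + 1) ^ tl : ℕ) : ℤ) * y.1.2 μ + (((ℓ + 1) ^ tl : ℕ) : ℤ) := by
        have : (((ℓ + 1) ^ y.1.1 : ℕ) : ℤ) = (((ℓ + 1) ^ tl : ℕ) : ℤ) := by rw [ht]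
        linarith
      nlinarith
  calc F.card ≤ B.card := Finset.card_le_card_of_injOn (rep (Mk t.P t.j)) hinto ((rep_injective t).injOn)
    _ = (ℓ + 1) ^ (d + 1) := hBcard

/-- `(labels of b₋, direction)` determines the bond of `T_η`. [cite: Balaban1984PropagatorsII, p.224 («Ω also the set of bonds»), dictionary] -/
theorem injOn_posV_dir (W : Finset (PBond (PV d ℓ m K hd hL) 0)) :
    Set.InjOn (fun b : PBond (PV d ℓ m K hd hL) 0 => (posV b, b.dir)) ↑W := by
  intro b _ b' _ h
  simp only [Prod.mk.injEq] at h
  obtain ⟨h1, h2⟩ := h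
  have hsrc : b.src = b'.src := by
    funext μ
    have hμ := congrFun h1 μ
    simp only [posV, Nat.cast_inj] at hμ
    exact ZMod.val_injective _ hμ
  cases b
  cases b'
  simp only at hsrc h2
  subst hsrc
  subst h2
  rfl

variable {t}
variable {x₀ : Fin (d + 1) → ℤ} {hx₀ : ∀ μ, 0 ≤ x₀ μ} {hfit : ∀ μ, x₀ μ + (t.P.sitesPerDir 0 : ℕ) ≤ ((PV d ℓ m K hd hL).sitesPerDir 0 : ℕ)}

/-- the bonds of the full window lie in the window `[x₀, x₀ + 2L^{m+K})`. [cite: Balaban1984PropagatorsII, p.238 (T_□ = □̃³), bookkeeping] -/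
theorem inWindow_of_mem_W {b : PBond (PV d ℓ m K hd hL) 0} (hb : b ∈ (cB t x₀ hx₀ hfit).W) : InWindow posV x₀ (t.P.sitesPerDir 0) b := by
  intro μ
  have h := (mem_cB_W (hx₀ := hx₀) (hfit := hfit)).1 hb μ
  simp only [Nat.cast_zero, add_zero] at h
  exact h

variable {Mh k R : ℕ} {P' : Fin (d + 1) → ℕ} (hN : ∀ μ, N0 ℓ Mh k P' μ = (PV d ℓ m K hd hL).sitesPerDir 0) (D : TDomains d ℓ Mh k P' R)

/-- the distance input on the full window: `d_T(y(b), y(b₁)) ≤ (d+1)·|b₋ − b₁₋|_∞/L^j + (d+1)` when every window site has level `≥ j`.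
[cite: Balaban1984PropagatorsII, p.232 (before (2.53)), (2.46) p.231] -/
theorem hglob_W (hMh : 1 ≤ Mh) (hP : ∀ μ, 1 ≤ P' μ)
    (hlev : ∀ z ∈ boxDom (N0 ℓ Mh k P'), (∀ μ, x₀ μ ≤ z μ ∧ z μ < x₀ μ + (t.P.sitesPerDir 0 : ℕ)) → t.j ≤ D.lev z) :
    ∀ b ∈ (cB t x₀ hx₀ hfit).W, ∀ b₁ ∈ (cB t x₀ hx₀ hfit).W,
      (geomT D).dist (blkV1 hN D b) (blkV1 hN D b₁) ≤ (d + 1 : ℝ) * (supNorm (posV b - posV b₁) / (((ℓ + 1) ^ t.j : ℕ) : ℝ)) + (d + 1 : ℝ) := by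
  intro b hb b₁ hb₁
  have hbox := hglob_sites t D.toDomains hMh hP (fun b : PBond (PV d ℓ m K hd hL) 0 => toBox hN b.src) x₀ (t.P.sitesPerDir 0) hlev
    (cB t x₀ hx₀ hfit).W (fun b hb => inWindow_of_mem_W hb) Set.univ b hb b₁ hb₁ (Set.mem_univ _) (Set.mem_univ _)
  have hT : (((bondT D).dist (blkV1 hN D b) (blkV1 hN D b₁) : ℕ) : ℝ)
      ≤ (((bond D.toDomains).dist (blkV1 hN D b) (blkV1 hN D b₁) : ℕ) : ℝ) := by
    exact_mod_cast distT_le_dist_box (D := D) hMh hP _ _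
  exact hT.trans hbox

/-- **THE BAND BRIDGE ON `T_η`, INPUT-LOCALISED FORM**: for a member operator `T′` with the (2.133)-shape majorant `A·e^{−δ|y−y′|_{T_□}}`
(`ineq2133_G`/`_DG`/`_DlaG`/`_QaQ`/`ineq288_twoScale` …), a corner `x₀ ≥ 0` with the full member period inside the box, `L^j ∣ x₀`, the full window
two-level (`j`, `j+1`), and a reach `S` all of whose window bonds have labels in the middle band (`C ≥ 1`): the full-window transplant `ε T′ ρ` has
`InMajorant (blkV1 hN D) (ε T′ ρ) S (L^{d+1}·A·e^{2δ/C}·e^{−(δ/((d+1)C))·d_T})` — inputs over `S`, outputs ANYWHERE.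
[cite: Balaban1984PropagatorsII, (2.133)–(2.134) p.247, (2.90)–(2.91) p.239, p.238 (T_□ = □̃³)] -/
theorem inDecay_window_V1 {T' : Module.End ℝ (PBond t.P 0 → ℝ)} {A δ : ℝ} (hA : 0 ≤ A) (hδ : 0 ≤ δ)
    (hT' : HasMajorant (g := tsGeo t 0 0) (fun b : PBond t.P 0 => iterBlockOf t.j b.src) T' (fun y y' => A * Real.exp (-(δ * t.tdist y y'))))
    (hMh : 1 ≤ Mh) (hP : ∀ μ, 1 ≤ P' μ) (hdiv : ∀ μ, (((ℓ + 1) ^ t.j : ℕ) : ℤ) ∣ x₀ μ)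
    (hlev : ∀ z ∈ boxDom (N0 ℓ Mh k P'), (∀ μ, x₀ μ ≤ z μ ∧ z μ < x₀ μ + (t.P.sitesPerDir 0 : ℕ)) → t.j ≤ D.lev z ∧ D.lev z ≤ t.j + 1)
    {C : ℕ} (hC : 1 ≤ C) (S : Set (geomT D).Site)
    (hband : ∀ b ∈ (cB t x₀ hx₀ hfit).W, blkV1 hN D b ∈ S → ∀ μ,
      ((t.P.sitesPerDir t.j : ℕ) : ℤ) ≤ (C + 1) * ((posV b μ - x₀ μ) / (((ℓ + 1) ^ t.j : ℕ) : ℤ) + 1) ∧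
        ((C : ℤ) + 1) * ((posV b μ - x₀ μ) / (((ℓ + 1) ^ t.j : ℕ) : ℤ)) ≤ C * ((t.P.sitesPerDir t.j : ℕ) : ℤ)) :
    InMajorant (g := geomT D) (blkV1 hN D) (transplant (cB t x₀ hx₀ hfit).W (eB t x₀) T') S
      (fun a b => ((ℓ + 1) ^ (d + 1) : ℕ) * ((A * Real.exp (δ * ((d + 1 : ℝ) + (d + 1)) / ((d + 1) * C))) *
        Real.exp (-(δ / ((d + 1) * C) * (geomT D).dist a b)))) := by
  classical
  rw [transplant_eB_eq]
  exact inMajorant_transplant_of_band t 0 0 (g := geomT D) (blkV1 hN D) S posV PBond.dir x₀ le_rfl (cB t x₀ hx₀ hfit).W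
    (fun b hb => inWindow_of_mem_W hb) (injOn_posV_dir _) hA hδ hT' hC hband (d + 1) (d + 1) (by positivity)
    (hglob_W hN D hMh hP fun z hz hw => (hlev z hz hw).1) ((ℓ + 1) ^ (d + 1))
    (fun y _ => hfib_sites_full t D.toDomains (fun b : PBond (PV d ℓ m K hd hL) 0 => toBox hN b.src) PBond.dir x₀ hdiv _ le_rfl hlev _
      (fun b hb => inWindow_of_mem_W hb) y)

/-- **THE BAND BRIDGE ON `T_η`, OUTPUT-LOCALISED FORM**: the same with the OUTPUT bonds over `S` in the band, inputs ANYWHERE.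
[cite: Balaban1984PropagatorsII, (2.133)–(2.134) p.247, (2.90)–(2.91) p.239, p.238 (T_□ = □̃³)] -/
theorem outDecay_window_V1 {T' : Module.End ℝ (PBond t.P 0 → ℝ)} {A δ : ℝ} (hA : 0 ≤ A) (hδ : 0 ≤ δ)
    (hT' : HasMajorant (g := tsGeo t 0 0) (fun b : PBond t.P 0 => iterBlockOf t.j b.src) T' (fun y y' => A * Real.exp (-(δ * t.tdist y y'))))
    (hMh : 1 ≤ Mh) (hP : ∀ μ, 1 ≤ P' μ) (hdiv : ∀ μ, (((ℓ + 1) ^ t.j : ℕ) : ℤ) ∣ x₀ μ)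
    (hlev : ∀ z ∈ boxDom (N0 ℓ Mh k P'), (∀ μ, x₀ μ ≤ z μ ∧ z μ < x₀ μ + (t.P.sitesPerDir 0 : ℕ)) → t.j ≤ D.lev z ∧ D.lev z ≤ t.j + 1)
    {C : ℕ} (hC : 1 ≤ C) (S : Set (geomT D).Site)
    (hband : ∀ b ∈ (cB t x₀ hx₀ hfit).W, blkV1 hN D b ∈ S → ∀ μ,
      ((t.P.sitesPerDir t.j : ℕ) : ℤ) ≤ (C + 1) * ((posV b μ - x₀ μ) / (((ℓ + 1) ^ t.j : ℕ) : ℤ) + 1) ∧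
        ((C : ℤ) + 1) * ((posV b μ - x₀ μ) / (((ℓ + 1) ^ t.j : ℕ) : ℤ)) ≤ C * ((t.P.sitesPerDir t.j : ℕ) : ℤ)) :
    OutMajorant (g := geomT D) (blkV1 hN D) (transplant (cB t x₀ hx₀ hfit).W (eB t x₀) T') S
      (fun a b => ((ℓ + 1) ^ (d + 1) : ℕ) * ((A * Real.exp (δ * ((d + 1 : ℝ) + (d + 1)) / ((d + 1) * C))) *
        Real.exp (-(δ / ((d + 1) * C) * (geomT D).dist a b)))) := by
  classical
  rw [transplant_eB_eq]
  exact outMajorant_transplant_of_band t 0 0 (g := geomT D) (blkV1 hN D) S posV PBond.dir x₀ le_rfl (cB t x₀ hx₀ hfit).W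
    (fun b hb => inWindow_of_mem_W hb) (injOn_posV_dir _) hA hδ hT' hC hband (d + 1) (d + 1) (by positivity)
    (hglob_W hN D hMh hP fun z hz hw => (hlev z hz hw).1) ((ℓ + 1) ^ (d + 1))
    (fun y => hfib_sites_full t D.toDomains (fun b : PBond (PV d ℓ m K hd hL) 0 => toBox hN b.src) PBond.dir x₀ hdiv _ le_rfl hlev _
      (fun b hb => inWindow_of_mem_W hb) y)

end V1

end Literature.MathematicalPhysics.QuantumFieldTheory.Balaban1983to89.B6InDecayWindowV1

end
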